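import Literature.Analysis.FluidPDE.PassiveScalarDiagGalerkinIdentity
import HarnessLib

/-!
# The Fourier–Galerkin energy argument for weak passive scalars with constant diagonal
# diffusion, III: truncation tails, the transport remainder and the source pairing

Analysis/FluidPDE proof-support file (everything proved). Quantitative inputs for the limit
`N → ∞` in the truncated energy identity of `PassiveScalarDiagGalerkinIdentity`, for a weak
solution `Torus.IsWeakScalarTransportDiagForcedOn T a κ u s θ₀ θ`:

* the slice energy `τ ↦ ∫ θ(τ)²` is essentially bounded and integrable on `(0,T)`
  (`exists_ae_integral_sq_le`, `integrableOn_integral_sq`), as is the truncated energy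
  `∑_{|k|≤N}|θ̂(τ)(k)|²` (`integrableOn_galerkin_energy`);
* **Parseval tails**: `∫ (θ(τ) - P_N θ(τ))² = ∫ θ(τ)² - ∑_{|k|≤N}|θ̂(τ)(k)|² ≤ ∫ θ(τ)²` a.e., the tail is
  integrable on `(0,T)` and `∫₀ᵀ∫ (θ - P_N θ)² → 0` by dominated convergence (`ae_galerkin_tail`,
  `integrableOn_galerkin_tail`, `tendsto_integral_galerkin_tail`; Robinson–Rodrigo–Sadowski 2016,
  Lemma 4.1);
* **the transport remainder**: `m ∫ ‖∇P_N φ‖² ≤ 4π² ∑ Q_a(k)|φ̂(k)|²` for `m ≤ aᵢ`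
  (`mul_integral_norm_sq_gradient_scalarTruncate_le`) and, for an `L^∞` drift,
  `|∫ (θ - P_Nθ)⟪u, ∇P_Nθ⟫| ≤ C_u √(∫(θ - P_Nθ)²) √(∫‖∇P_Nθ‖²)` a.e.
  (`exists_ae_abs_galerkin_remainder_le`, Cauchy–Schwarz);
* **the source pairing** for `∫₀ᵀ ‖s(t)‖_{L²} dt < ∞` (stated as
  `∫⁻_{(0,T)} (∫⁻ ‖s t‖ₑ²)^{1/2} < ⊤`, the form of the class's `L¹_t L²_x` drift condition):
  `s(τ) ∈ L²` a.e., `√(∫ s²) ∈ L¹(0,T)`, `|∫ s P_Nθ| ≤ √(∫s²)√(∫θ²)`,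
  `|∫ s P_Nθ - ∫ sθ| ≤ √(∫s²)√(∫(θ-P_Nθ)²)`, `∫ sθ ∈ L¹(0,T)`, and
  `∫_{(0,t]}∫ s P_Nθ → ∫_{(0,t]}∫ sθ` (`tendsto_integral_galerkin_source`, dominated convergence).

## References

* J. C. Robinson, J. L. Rodrigo, W. Sadowski, *The three-dimensional Navier–Stokes equations*
  (CUP 2016), Lemma 4.1, §4.2. [`RobinsonRodrigoSadowski2016`]
* P. Bonicatto, G. Ciampa, G. Crippa, J. Evol. Equ. 24 (2024), Paper No. 1, proof of Thm. 3.3.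
  [`BonicattoCiampaCrippa2023`]
* T. D. Drivas, T. M. Elgindi, G. Iyer, I.-J. Jeong, ARMA 243 (2022), (1.1). [`DEIJ2022`]
-/
noncomputable section

open _root_.MeasureTheory _root_.Set _root_.Filter _root_.Function _root_.TopologicalSpace
open scoped ENNReal NNReal InnerProductSpace ContDiff Topology
open Literature.Analysis.FunctionSpaces.Torus Literature.Analysis.FunctionSpaces UnitAddTorus

namespace Literature.Analysis.FluidPDE

variable {d : Type*} [Fintype d] [DecidableEq d]

namespace Torus

/-! ## Slice tools: `L²` conversions and Cauchy–Schwarz -/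

omit [DecidableEq d] in
/-- `∫⁻ ‖f‖ₑ² = ofReal (∫ ‖f‖²)` for `f ∈ L²(T^d)`. [folklore] -/
private theorem lintegral_enorm_sq_eq_ofReal_norm_sq {E : Type*} [NormedAddCommGroup E]
    {f : UnitAddTorus d → E} (hf : MemLp f 2 volume) :
    ∫⁻ x, ‖f x‖ₑ ^ 2 = ENNReal.ofReal (∫ x, ‖f x‖ ^ 2) := by
  rw [ofReal_integral_eq_lintegral_ofReal (hf.integrable_norm_pow two_ne_zero)
    (ae_of_all _ fun x => by positivity)]
  refine lintegral_congr_ae (ae_of_all _ fun x => ?_)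
  show ‖f x‖ₑ ^ 2 = ENNReal.ofReal (‖f x‖ ^ 2)
  rw [ENNReal.ofReal_pow (norm_nonneg _), ofReal_norm]

omit [DecidableEq d] in
/-- `∫⁻ ‖f‖ₑ² = ofReal (∫ f²)` for a real `f ∈ L²(T^d)`. [folklore] -/
private theorem lintegral_enorm_sq_eq_ofReal_sq' {f : UnitAddTorus d → ℝ} (hf : MemLp f 2 volume) :
    ∫⁻ x, ‖f x‖ₑ ^ 2 = ENNReal.ofReal (∫ x, f x ^ 2) := by
  rw [lintegral_enorm_sq_eq_ofReal_norm_sq hf]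
  congr 1
  exact integral_congr_ae (ae_of_all _ fun x => by simp [sq_abs])

omit [DecidableEq d] in
/-- From an `ℝ≥0∞` bound `∫⁻ ‖f‖ₑ² ≤ C` to the real bound `∫ f² ≤ C` for `f ∈ L²`. [folklore] -/
private theorem integral_sq_le_of_lintegral_le {f : UnitAddTorus d → ℝ} (hf : MemLp f 2 volume) {C : ℝ≥0}
    (h : ∫⁻ x, ‖f x‖ₑ ^ 2 ≤ C) : ∫ x, f x ^ 2 ≤ C := by
  rw [lintegral_enorm_sq_eq_ofReal_sq' hf] at h
  exact (ENNReal.ofReal_le_iff_le_toReal ENNReal.coe_ne_top).1 h |>.trans (by simp)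

omit [DecidableEq d] in
/-- **Cauchy–Schwarz on the torus**, real form: `∫ ‖f‖ ‖g‖ ≤ √(∫ f²) √(∫ g²)` for `f, g ∈ L²`.
[folklore] -/
private theorem integral_norm_mul_norm_le_sqrt_mul_sqrt {f g : UnitAddTorus d → ℝ} (hf : MemLp f 2 volume)
    (hg : MemLp g 2 volume) :
    ∫ x, ‖f x‖ * ‖g x‖ ≤ Real.sqrt (∫ x, f x ^ 2) * Real.sqrt (∫ x, g x ^ 2) := by
  have h := integral_mul_le_Lp_mul_Lq_of_nonneg (μ := (volume : Measure (UnitAddTorus d)))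
    Real.HolderConjugate.two_two (Eventually.of_forall fun x => norm_nonneg (f x))
    (Eventually.of_forall fun x => norm_nonneg (g x)) (by simpa using hf.norm) (by simpa using hg.norm)
  have e : ∀ (φ : UnitAddTorus d → ℝ), (∫ x, ‖φ x‖ ^ (2 : ℝ)) ^ (1 / (2 : ℝ)) = Real.sqrt (∫ x, φ x ^ 2) := by
    intro φ
    rw [Real.sqrt_eq_rpow]
    congr 1
    exact integral_congr_ae (ae_of_all _ fun x => by
      simp only [Real.rpow_two, Real.norm_eq_abs, sq_abs])
  rwa [e, e] at h

omit [DecidableEq d] in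
/-- **Weighted Cauchy–Schwarz**: `|∫ f ⟪v, G⟫| ≤ C √(∫ f²) √(∫ ‖G‖²)` for `f ∈ L²`, continuous `G`
and an a.e.-bounded `v`, `‖v‖ ≤ C` a.e. [folklore] -/
private theorem abs_integral_mul_inner_le_of_ae_norm_le {f : UnitAddTorus d → ℝ} {v G : UnitAddTorus d → EuclideanSpace ℝ d}
    {C : ℝ} (hC : 0 ≤ C) (hf : MemLp f 2 volume) (hvC : ∀ᵐ x ∂volume, ‖v x‖ ≤ C) (hG : Continuous G) :
    |∫ x, f x * ⟪v x, G x⟫_ℝ| ≤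
      C * (Real.sqrt (∫ x, f x ^ 2) * Real.sqrt (∫ x, ‖G x‖ ^ 2)) := by
  have hGm : MemLp (fun x => ‖G x‖) 2 volume := by
    obtain ⟨M, hM⟩ := exists_forall_norm_le_of_continuous hG
    exact MemLp.of_bound hG.norm.aestronglyMeasurable M (Eventually.of_forall fun x => by simpa using hM x)
  have hI : Integrable (fun x => C * (‖f x‖ * ‖‖G x‖‖)) volume :=
    (hf.norm.integrable_mul hGm.norm).const_mul C
  calc |∫ x, f x * ⟪v x, G x⟫_ℝ| ≤ ∫ x, C * (‖f x‖ * ‖‖G x‖‖) := by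
        rw [← Real.norm_eq_abs]
        refine norm_integral_le_of_norm_le hI ?_
        filter_upwards [hvC] with x hx
        rw [norm_mul, norm_norm]
        calc ‖f x‖ * ‖⟪v x, G x⟫_ℝ‖ ≤ ‖f x‖ * (C * ‖G x‖) :=
              mul_le_mul_of_nonneg_left ((norm_inner_le_norm _ _).trans
                (mul_le_mul_of_nonneg_right hx (norm_nonneg _))) (norm_nonneg _)
          _ = C * (‖f x‖ * ‖G x‖) := by ring
    _ = C * ∫ x, ‖f x‖ * ‖‖G x‖‖ := integral_const_mul _ _
    _ ≤ C * (Real.sqrt (∫ x, f x ^ 2) * Real.sqrt (∫ x, ‖G x‖ ^ 2)) :=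
        mul_le_mul_of_nonneg_left (integral_norm_mul_norm_le_sqrt_mul_sqrt hf hGm) hC

namespace IsWeakScalarTransportDiagForcedOn

variable {T κ : ℝ} {a : d → ℝ} {u : ℝ → UnitAddTorus d → EuclideanSpace ℝ d} {s : ℝ → UnitAddTorus d → ℝ}
  {θ₀ : UnitAddTorus d → ℝ} {θ : ℝ → UnitAddTorus d → ℝ}

/-! ## The slice energy `∫ θ(τ)²` -/

/-- **A real `L^∞_t L²_x` bound**: `∫ θ(τ)² ≤ C` for a.e. `τ ∈ (0,T)`. [cite: DiPernaLions1989, §II.1 (12)–(14)] -/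
theorem exists_ae_integral_sq_le (h : IsWeakScalarTransportDiagForcedOn T a κ u s θ₀ θ) :
    ∃ C : ℝ, 0 ≤ C ∧ ∀ᵐ τ ∂(volume.restrict (Ioo 0 T)), ∫ x, θ τ x ^ 2 ≤ C := by
  obtain ⟨C, hC⟩ := h.ae_lintegral_sq_le
  refine ⟨C, C.2, ?_⟩
  filter_upwards [hC, h.ae_memLp_two] with τ hτ hm
  exact integral_sq_le_of_lintegral_le hm hτ

/-- The slice energy `τ ↦ ∫ θ(τ)²` is integrable on `(0,T)` (measurable by Fubini, essentially
bounded). [cite: DiPernaLions1989, §II.1 (12)–(14)] -/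
theorem integrableOn_integral_sq (h : IsWeakScalarTransportDiagForcedOn T a κ u s θ₀ θ) :
    IntegrableOn (fun τ => ∫ x, θ τ x ^ 2) (Ioo 0 T) volume := by
  obtain ⟨C, hC0, hC⟩ := h.exists_ae_integral_sq_le
  have hm : AEStronglyMeasurable (fun τ => ∫ x, θ τ x ^ 2) (volume.restrict (Ioo 0 T)) :=
    ((continuous_pow 2).comp_aestronglyMeasurable h.aestronglyMeasurable_uncurry).integral_prod_right'
  refine Integrable.mono' (g := fun _ => C) ?_ hm ?_
  · exact integrableOn_const (hs := measure_Ioo_lt_top.ne) |>.integrable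
  · filter_upwards [hC] with τ hτ
    rw [Real.norm_eq_abs, abs_of_nonneg (integral_nonneg fun x => sq_nonneg _)]
    exact hτ

/-- **The truncated energy is integrable in time**: `τ ↦ ∑_{|k|≤N} |θ̂(τ)(k)|² ∈ L¹(0,T)`.
[cite: RobinsonRodrigoSadowski2016, §4.2 (Galerkin energy estimate)] -/
theorem integrableOn_galerkin_energy (h : IsWeakScalarTransportDiagForcedOn T a κ u s θ₀ θ) (N : ℕ) :
    IntegrableOn (fun τ => ∑ k ∈ freqBall N, ‖mFourierCoeff (fun x => (θ τ x : ℂ)) k‖ ^ 2) (Ioo 0 T) volume := by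
  refine (integrable_finsetSum (freqBall N) fun k _ => h.integrableOn_pairing_sq k).congr ?_
  filter_upwards [h.ae_slice_integrable] with τ hτ
  simp only [sq_norm_mFourierCoeff_ofReal hτ.1, sq]

/-! ## The truncation tail `∫ (θ - P_N θ)²` -/

/-- For a.e. `τ`, the Parseval tail identity and bound on the slice:
`∫ (θ(τ) - P_N θ(τ))² = ∫ θ(τ)² - ∑_{|k|≤N} |θ̂(τ)(k)|² ≤ ∫ θ(τ)²`, and the tail tends to `0`.
[cite: RobinsonRodrigoSadowski2016, Lemma 4.1] -/
theorem ae_galerkin_tail (h : IsWeakScalarTransportDiagForcedOn T a κ u s θ₀ θ) :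
    ∀ᵐ τ ∂(volume.restrict (Ioo 0 T)),
      (∀ N : ℕ, ∫ x, (θ τ x - scalarTruncate N (θ τ) x) ^ 2 =
        (∫ x, θ τ x ^ 2) - ∑ k ∈ freqBall N, ‖mFourierCoeff (fun x => (θ τ x : ℂ)) k‖ ^ 2) ∧
      (∀ N : ℕ, ∫ x, (θ τ x - scalarTruncate N (θ τ) x) ^ 2 ≤ ∫ x, θ τ x ^ 2) ∧
      Tendsto (fun N => ∫ x, (θ τ x - scalarTruncate N (θ τ) x) ^ 2) atTop (𝓝 0) := by
  filter_upwards [h.ae_memLp_two] with τ hm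
  exact ⟨fun N => integral_sq_sub_scalarTruncate hm N, fun N => integral_sq_sub_scalarTruncate_le hm N,
    tendsto_integral_sq_sub_scalarTruncate hm⟩

/-- The truncation tail `τ ↦ ∫ (θ(τ) - P_N θ(τ))²` is integrable on `(0,T)`.
[cite: RobinsonRodrigoSadowski2016, Lemma 4.1] -/
theorem integrableOn_galerkin_tail (h : IsWeakScalarTransportDiagForcedOn T a κ u s θ₀ θ) (N : ℕ) :
    IntegrableOn (fun τ => ∫ x, (θ τ x - scalarTruncate N (θ τ) x) ^ 2) (Ioo 0 T) volume := by
  refine (h.integrableOn_integral_sq.sub (h.integrableOn_galerkin_energy N)).congr_fun_ae ?_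
  filter_upwards [h.ae_galerkin_tail] with τ hτ
  exact (hτ.1 N).symm

/-- **The integrated truncation tail vanishes**: `∫_{(0,T)} ∫ (θ - P_N θ)² → 0` as `N → ∞`
(dominated convergence: slice-wise Parseval tails, dominated by `∫ θ(τ)² ∈ L¹(0,T)`).
[cite: RobinsonRodrigoSadowski2016, Lemma 4.1] -/
theorem tendsto_integral_galerkin_tail (h : IsWeakScalarTransportDiagForcedOn T a κ u s θ₀ θ) :
    Tendsto (fun N => ∫ τ in Ioo 0 T, ∫ x, (θ τ x - scalarTruncate N (θ τ) x) ^ 2) atTop (𝓝 0) := by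
  have hlim := tendsto_integral_of_dominated_convergence (μ := volume.restrict (Ioo 0 T))
    (F := fun N τ => ∫ x, (θ τ x - scalarTruncate N (θ τ) x) ^ 2) (f := fun _ => 0)
    (fun τ => ∫ x, θ τ x ^ 2) (fun N => (h.integrableOn_galerkin_tail N).aestronglyMeasurable)
    h.integrableOn_integral_sq (fun N => ?_) ?_
  · simpa using hlim
  · filter_upwards [h.ae_galerkin_tail] with τ hτ
    rw [Real.norm_eq_abs, abs_of_nonneg (integral_nonneg fun x => sq_nonneg _)]
    exact hτ.2.1 N
  · filter_upwards [h.ae_galerkin_tail] with τ hτ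
    exact hτ.2.2

/-! ## The transport remainder -/

/-- **Gradient of the truncation versus the truncated `A`-dissipation**:
`m ∫ ‖∇P_N φ‖² ≤ 4π² ∑_{|k|≤N} Q_a(k) |φ̂(k)|²` whenever `m ≤ aᵢ` for all `i`
(`∫ ‖∇P_N φ‖² = 4π² ∑ |k|² |φ̂(k)|²`, `m|k|² ≤ Q_a(k)`).
[cite: HessChildsRowan2025a, App. A (non-isotropic diffusions, modified constants)] -/
theorem mul_integral_norm_sq_gradient_scalarTruncate_le {m : ℝ} (hma : ∀ i, m ≤ a i) (N : ℕ)
    (φ : UnitAddTorus d → ℝ) :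
    m * ∫ x, ‖gradient (scalarTruncate N φ) x‖ ^ 2 ≤
      4 * Real.pi ^ 2 * ∑ k ∈ freqBall N, Torus.diagSymbol a k * ‖mFourierCoeff (fun x => (φ x : ℂ)) k‖ ^ 2 := by
  rw [integral_norm_sq_gradient_scalarTruncate, mul_left_comm, Finset.mul_sum, Finset.mul_sum, Finset.mul_sum]
  refine Finset.sum_le_sum fun k _ => mul_le_mul_of_nonneg_left ?_ (by positivity)
  rw [← mul_assoc]
  exact mul_le_mul_of_nonneg_right (Torus.mul_freqNormSq_le_diagSymbol hma k) (sq_nonneg _)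

/-- **The transport remainder is controlled by the truncation tail and the truncated gradient**:
for an `L^∞` drift with `‖u‖ ≤ C_u` a.e., for every `N` and a.e. `τ`,
`|∫ (θ - P_N θ) ⟪u, ∇P_N θ⟫| ≤ C_u √(∫ (θ - P_N θ)²) √(∫ ‖∇P_N θ‖²)` (Cauchy–Schwarz).
[cite: RobinsonRodrigoSadowski2016, §4.2 (Galerkin energy estimate)] -/
theorem exists_ae_abs_galerkin_remainder_le (h : IsWeakScalarTransportDiagForcedOn T a κ u s θ₀ θ)
    (hu : MemLp (stLift u) ∞ (volume.restrict (Ioo 0 T ×ˢ univ))) :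
    ∃ Cu : ℝ, 0 ≤ Cu ∧ ∀ N : ℕ, ∀ᵐ τ ∂(volume.restrict (Ioo 0 T)),
      |∫ x, (θ τ x - scalarTruncate N (θ τ) x) * ⟪u τ x, gradient (scalarTruncate N (θ τ)) x⟫_ℝ| ≤
        Cu * (Real.sqrt (∫ x, (θ τ x - scalarTruncate N (θ τ) x) ^ 2) *
          Real.sqrt (∫ x, ‖gradient (scalarTruncate N (θ τ)) x‖ ^ 2)) := by
  obtain ⟨Cu, hCu0, hCu⟩ := ae_ae_norm_le_of_memLp_top_stLift hu
  refine ⟨Cu, hCu0, fun N => ?_⟩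
  filter_upwards [hCu, h.ae_memLp_two] with τ hb hm
  exact abs_integral_mul_inner_le_of_ae_norm_le hCu0 (hm.sub (memLp_scalarTruncate N (θ τ) 2)) hb
    (isSmooth_scalarTruncate N (θ τ)).gradient.continuous

/-! ## The source pairing (`s ∈ L¹_t L²_x`) -/

/-- For a source with `∫₀ᵀ ‖s(t)‖_{L²} dt < ∞`, the slices `s(τ)` lie in `L²` for a.e. `τ`.
[cite: DEIJ2022, (1.1)] -/
theorem ae_memLp_two_source (h : IsWeakScalarTransportDiagForcedOn T a κ u s θ₀ θ)
    (hs : ∫⁻ t in Ioo 0 T, (∫⁻ x, ‖s t x‖ₑ ^ 2) ^ (1 / 2 : ℝ) < ⊤) :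
    ∀ᵐ τ ∂(volume.restrict (Ioo 0 T)), MemLp (s τ) 2 volume := by
  have hG : AEMeasurable (fun t => (∫⁻ x, ‖s t x‖ₑ ^ 2) ^ (1 / 2 : ℝ)) (volume.restrict (Ioo 0 T)) :=
    ((h.aestronglyMeasurable_uncurry_source.enorm.pow_const 2).lintegral_prod_right').pow_const _
  filter_upwards [ae_lt_top' hG hs.ne, h.ae_slice_integrable] with t ht hsl
  refine ⟨hsl.2.2.2.aestronglyMeasurable, ?_⟩
  rw [eLpNorm_eq_lintegral_rpow_enorm_toReal two_ne_zero ENNReal.ofNat_ne_top, ENNReal.toReal_ofNat]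
  have h2 : ∫⁻ x, ‖s t x‖ₑ ^ (2 : ℝ) = ∫⁻ x, ‖s t x‖ₑ ^ 2 := lintegral_congr fun x => ENNReal.rpow_two _
  rw [h2]
  exact ht

/-- The real slice norm `τ ↦ √(∫ s(τ)²)` is integrable on `(0,T)` when `∫₀ᵀ ‖s(t)‖_{L²} dt < ∞`.
[cite: DEIJ2022, (1.1)] -/
theorem integrableOn_sqrt_integral_sq_source (h : IsWeakScalarTransportDiagForcedOn T a κ u s θ₀ θ)
    (hs : ∫⁻ t in Ioo 0 T, (∫⁻ x, ‖s t x‖ₑ ^ 2) ^ (1 / 2 : ℝ) < ⊤) :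
    IntegrableOn (fun τ => Real.sqrt (∫ x, s τ x ^ 2)) (Ioo 0 T) volume := by
  have hG : AEMeasurable (fun t => (∫⁻ x, ‖s t x‖ₑ ^ 2) ^ (1 / 2 : ℝ)) (volume.restrict (Ioo 0 T)) :=
    ((h.aestronglyMeasurable_uncurry_source.enorm.pow_const 2).lintegral_prod_right').pow_const _
  refine (integrable_toReal_of_lintegral_ne_top hG hs.ne).congr ?_
  filter_upwards [h.ae_memLp_two_source hs] with τ hm
  rw [lintegral_enorm_sq_eq_ofReal_sq' hm, ENNReal.ofReal_rpow_of_nonneg (integral_nonneg fun x => sq_nonneg _)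
    (by norm_num), ENNReal.toReal_ofReal (Real.rpow_nonneg (integral_nonneg fun x => sq_nonneg _) _),
    Real.sqrt_eq_rpow]

/-- **Source pairing bounds**, for a.e. `τ`: `|∫ s P_N θ| ≤ √(∫ s²) √(∫ θ²)` (Cauchy–Schwarz and
Bessel `∫ (P_N θ)² ≤ ∫ θ²`) and `|∫ s P_N θ - ∫ s θ| ≤ √(∫ s²) √(∫ (θ - P_N θ)²)`.
[cite: RobinsonRodrigoSadowski2016, §4.2 (Galerkin energy estimate)] -/
theorem ae_abs_galerkin_source_le (h : IsWeakScalarTransportDiagForcedOn T a κ u s θ₀ θ)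
    (hs : ∫⁻ t in Ioo 0 T, (∫⁻ x, ‖s t x‖ₑ ^ 2) ^ (1 / 2 : ℝ) < ⊤) :
    ∀ᵐ τ ∂(volume.restrict (Ioo 0 T)), ∀ N : ℕ,
      |∫ x, s τ x * scalarTruncate N (θ τ) x| ≤ Real.sqrt (∫ x, s τ x ^ 2) * Real.sqrt (∫ x, θ τ x ^ 2) ∧
      |(∫ x, s τ x * scalarTruncate N (θ τ) x) - ∫ x, s τ x * θ τ x| ≤
        Real.sqrt (∫ x, s τ x ^ 2) * Real.sqrt (∫ x, (θ τ x - scalarTruncate N (θ τ) x) ^ 2) := by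
  filter_upwards [h.ae_memLp_two_source hs, h.ae_memLp_two] with τ hsm hm N
  have hP : MemLp (scalarTruncate N (θ τ)) 2 volume := memLp_scalarTruncate N (θ τ) 2
  have hcs : ∀ {g : UnitAddTorus d → ℝ}, MemLp g 2 volume →
      |∫ x, s τ x * g x| ≤ Real.sqrt (∫ x, s τ x ^ 2) * Real.sqrt (∫ x, g x ^ 2) := by
    intro g hg
    calc |∫ x, s τ x * g x| ≤ ∫ x, ‖s τ x‖ * ‖g x‖ := by
          rw [← Real.norm_eq_abs]
          refine (norm_integral_le_integral_norm _).trans (le_of_eq ?_)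
          exact integral_congr_ae (ae_of_all _ fun x => norm_mul _ _)
      _ ≤ _ := integral_norm_mul_norm_le_sqrt_mul_sqrt hsm hg
  constructor
  · refine (hcs hP).trans (mul_le_mul_of_nonneg_left (Real.sqrt_le_sqrt ?_) (Real.sqrt_nonneg _))
    rw [integral_sq_scalarTruncate]
    exact sum_sq_norm_mFourierCoeff_le_integral_sq hm N
  · have e : (∫ x, s τ x * scalarTruncate N (θ τ) x) - ∫ x, s τ x * θ τ x =
        -∫ x, s τ x * (θ τ x - scalarTruncate N (θ τ) x) := by
      have i1 : Integrable (fun x => s τ x * scalarTruncate N (θ τ) x) volume := hsm.integrable_mul hP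
      have i2 : Integrable (fun x => s τ x * θ τ x) volume := hsm.integrable_mul hm
      rw [← integral_sub i1 i2, ← integral_neg]
      exact integral_congr_ae (ae_of_all _ fun x => by ring)
    rw [e, abs_neg]
    exact hcs (hm.sub hP)

/-- The source pairing with the solution, `τ ↦ ∫ s(τ) θ(τ)`, is integrable on `(0,T)`.
[cite: DEIJ2022, (1.1)] -/
theorem integrableOn_integral_source_mul (h : IsWeakScalarTransportDiagForcedOn T a κ u s θ₀ θ)
    (hs : ∫⁻ t in Ioo 0 T, (∫⁻ x, ‖s t x‖ₑ ^ 2) ^ (1 / 2 : ℝ) < ⊤) :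
    IntegrableOn (fun τ => ∫ x, s τ x * θ τ x) (Ioo 0 T) volume := by
  obtain ⟨C, hC0, hC⟩ := h.exists_ae_integral_sq_le
  have hm : AEStronglyMeasurable (fun τ => ∫ x, s τ x * θ τ x) (volume.restrict (Ioo 0 T)) :=
    (h.aestronglyMeasurable_uncurry_source.mul h.aestronglyMeasurable_uncurry).integral_prod_right'
  refine Integrable.mono' ((h.integrableOn_sqrt_integral_sq_source hs).mul_const (Real.sqrt C)) hm ?_
  filter_upwards [h.ae_memLp_two_source hs, h.ae_memLp_two, hC] with τ hsm hθm hτ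
  rw [Real.norm_eq_abs]
  calc |∫ x, s τ x * θ τ x| ≤ ∫ x, ‖s τ x‖ * ‖θ τ x‖ := by
        rw [← Real.norm_eq_abs]
        refine (norm_integral_le_integral_norm _).trans (le_of_eq ?_)
        exact integral_congr_ae (ae_of_all _ fun x => norm_mul _ _)
    _ ≤ Real.sqrt (∫ x, s τ x ^ 2) * Real.sqrt (∫ x, θ τ x ^ 2) := integral_norm_mul_norm_le_sqrt_mul_sqrt hsm hθm
    _ ≤ Real.sqrt (∫ x, s τ x ^ 2) * Real.sqrt C :=
        mul_le_mul_of_nonneg_left (Real.sqrt_le_sqrt hτ) (Real.sqrt_nonneg _)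

/-- **The integrated Galerkin source pairing converges**: for every `t`,
`∫_{(0,t]∩(0,T)} ∫ s P_N θ → ∫ ∫ s θ`; stated on `(0,t]` for `t < T`… here for sub-intervals
`Ioc 0 t ⊆ Ioo 0 T` (dominated convergence, bound `√(∫ s²) √C`).
[cite: RobinsonRodrigoSadowski2016, §4.2 (Galerkin energy estimate)] -/
theorem tendsto_integral_galerkin_source (h : IsWeakScalarTransportDiagForcedOn T a κ u s θ₀ θ)
    (hs : ∫⁻ t in Ioo 0 T, (∫⁻ x, ‖s t x‖ₑ ^ 2) ^ (1 / 2 : ℝ) < ⊤) {t : ℝ} (ht : t < T) :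
    Tendsto (fun N => ∫ τ in Ioc 0 t, ∫ x, s τ x * scalarTruncate N (θ τ) x) atTop
      (𝓝 (∫ τ in Ioc 0 t, ∫ x, s τ x * θ τ x)) := by
  obtain ⟨C, hC0, hC⟩ := h.exists_ae_integral_sq_le
  have hsub : Ioc 0 t ⊆ Ioo 0 T := Ioc_subset_Ioo_right ht
  refine tendsto_integral_of_dominated_convergence (μ := volume.restrict (Ioc 0 t))
    (fun τ => Real.sqrt (∫ x, s τ x ^ 2) * Real.sqrt C)
    (fun N => ((h.integrableOn_galerkin_source N).mono_set hsub).aestronglyMeasurable)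
    ((show IntegrableOn (fun τ => Real.sqrt (∫ x, s τ x ^ 2) * Real.sqrt C) (Ioo 0 T) volume from
      (h.integrableOn_sqrt_integral_sq_source hs).mul_const _).mono_set hsub) (fun N => ?_) ?_
  · refine ae_restrict_of_ae_restrict_of_subset hsub ?_
    filter_upwards [h.ae_abs_galerkin_source_le hs, hC] with τ hτ hτC
    rw [Real.norm_eq_abs]
    exact (hτ N).1.trans (mul_le_mul_of_nonneg_left (Real.sqrt_le_sqrt hτC) (Real.sqrt_nonneg _))
  · refine ae_restrict_of_ae_restrict_of_subset hsub ?_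
    filter_upwards [h.ae_abs_galerkin_source_le hs, h.ae_galerkin_tail] with τ hτ htail
    rw [tendsto_iff_norm_sub_tendsto_zero]
    have h0 : Tendsto (fun N => Real.sqrt (∫ x, s τ x ^ 2) *
        Real.sqrt (∫ x, (θ τ x - scalarTruncate N (θ τ) x) ^ 2)) atTop (𝓝 0) := by
      have := (Real.continuous_sqrt.tendsto 0).comp htail.2.2
      rw [Real.sqrt_zero] at this
      simpa using this.const_mul (Real.sqrt (∫ x, s τ x ^ 2))
    exact squeeze_zero (fun N => norm_nonneg _) (fun N => by rw [Real.norm_eq_abs]; exact (hτ N).2) h0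

end IsWeakScalarTransportDiagForcedOn

end Torus

end Literature.Analysis.FluidPDE

end
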